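import Mathlib.Analysis.SpecialFunctions.Pow.Integral
import Mathlib.Analysis.SpecialFunctions.Integrability.Basic
import Literature.Analysis.FluidPDE.PineauVicolOneSliceAssembly
import Literature.Analysis.FluidPDE.SlicePressureIdentity
import Literature.Analysis.FluidPDE.CKNLocalRegularityRRSPressure
import Literature.Analysis.FluidPDE.CKNScalingExtras
import HarnessLib

/-!
# Pineau–Vicol 2026, Theorem 1.9 — the printed proof: the pressure class `p ∈ L^{3/2}`
  (Proposition 9.5 with both integrability inputs discharged)

Analysis/FluidPDE proof file, fifth sibling of `PineauVicolOneSlice.lean` (the named fact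
`Literature.Analysis.FluidPDE.pineauVicol2026_oneSlice_regularity`, B. Pineau, V. Vicol,
arXiv:2607.09619 (2026), Thm. 1.9). The proof of Prop. 9.5 (p. 33) needs, besides the interior
suitability, that `(u, p)` has the global integrability of a suitable weak solution near the
vertex `(0, 0)`: "By (1.15) and Lemma 9.2 we have `u ∈ L^∞_t L²_x` and `∇u ∈ L²_{x,t}`. To
prove integrability of the pressure, fix `φ ∈ C_c^∞(B_{7/8})` … and write `p = p_loc + h` on
`B_{3/4}`, where `p_loc(·, t)` is the Newtonian potential of `∂ᵢ∂ⱼ(φ uᵢuⱼ)(·, t)`, and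
`Δh(·, t) = 0` in `B_{3/4}`. By (1.15) … and standard Calderón–Zygmund estimates, we obtain
`p_loc ∈ L^{3/2}_{x,t}` …; the assumption `p ∈ L^∞(A × (−1,0))` then gives `h ∈ L^∞(A × (−1,0))`
… The fact that `h ∈ L^{3/2}_{x,t}` follows from the maximum principle."

Here this step is carried out in **dual form** (the device of the tree's proof of
Robinson–Rodrigo–Sadowski Lemma 15.12, `CKNLocalRegularityRRSPressure`): the Newtonian kernel is
put on the test function, so that neither the harmonic part `h` nor the maximum principle is
needed — the far field enters only through the bounded smoothing remainder, supported in the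
annulus `A` where (1.16) controls `p`. For a slice `v = u(t)`, `π = p(t)`, `−1 < t < 0`, and a
test function `g` supported in `B(0, 1/32)`, let `Θ = N^{9/16,11/16}[g]` be the truncated
Newtonian potential of `g` (tree `NewtonLocalPotential`; `Θ ∈ C_c^∞`,
`supp Θ ⊆ B̄(0, 23/32) ⊂ B_{3/4}`, `ΔΘ = g − Λ[g]` with `Λ[g] = λ ⋆ g` supported in the shell
`17/32 ≤ |x| ≤ 23/32 ⊂ A = {1/2 < |x| < 3/4}`). The weak slice pressure equation
`∫ π ΔΘ = −∫ D²Θ(v, v)` of a classical solution (`SlicePressureIdentity`) gives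

  `∫ π g = ∫ π Λ[g] − ∫ D²Θ(v, v)`,

whence `|∫ π g| ≤ (9 A ‖v‖²_{L³(B_{3/4})} + C_p C_Λ) ‖g‖_{L³}` by Hölder, the Calderón–Zygmund
bound `‖D²N[g]‖_{L³} ≤ A ‖g‖_{L³}` (Stein 1970, Ch. III §1.3 Prop. 3 — the tree's theorem
`stein1970_hessian_Lp_bound_holds_fin3`) and (1.16); the converse of Hölder's inequality
(`FunctionSpaces.lintegral_rpow_enorm_le_of_forall_test`) turns this into
`∫_{B_{1/32}} |p(t)|^{3/2} ≤ C₁ ∫_{B_{3/4}} |u(t)|³ + C₂`, and `u ∈ L³((−1,0) × B₁)` by the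
Type I bound (1.15) (`∫∫ (√(−t) + |x|)⁻³ < ∞`). Contents:

* `lintegral_typeI_cube_le`, `lintegral_typeI_cube_lt_top` — `u ∈ L³((−1, 0) × B₁)` from
  (1.15), with the bound `C_u³ · const`;
* `lintegral_enorm_hessian_apply_le_of_tsupport_subset`,
  `exists_abs_integral_mul_newtonFarSmoothing_le`, `abs_integral_mul_test_le_of_slice_identity`,
  `lintegral_ball_enorm_rpow_threeHalves_le_of_forall_test` — the dual estimate and duality;
* `exists_forall_lintegral_ball_pressure_rpow_le` — the slice bound for the solutions of
  Theorem 1.9, uniformly in `t ∈ (−1, 0)` and in the solution (constants `C₁`, `C₂(C_p)`);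
* `exists_lintegral_pressure_rpow_threeHalves_le`, `lintegral_pressure_rpow_threeHalves_lt_top`,
  `memLp_pressure_threeHalves` — **`p ∈ L^{3/2}((−1,0) × B_{1/32})`**, with a bound
  `B(C_u, C_p)` fixed before the solution (needed again for the Type I bounds of `∇u`);
* `memLp_nsRescalePressure_threeHalves` — hence the zoom `p_c = c² p(c²·, c·)` lies in
  `L^{3/2}(Q₁)` for every `0 < c ≤ 1/32` (input (I2) of `pineauVicol_regular_of_zoom`);
* `pineauVicol_regular_of_zoom_small` — **Prop. 9.5 for the solutions of Theorem 1.9 modulo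
  the smallness of the dissipation only**: for `0 < c ≤ 1/32`, if
  `sup_{0<r<1} r⁻¹ ∫∫_{Q_r} |∇u_c|² < ε` then `u` is bounded on `B_r × (−r², 0)` for some
  `r > 0` — the conclusion of the vendored fact. What remains for
  `pineauVicol2026_oneSlice_regularity_holds` is the smallness (I3): §9.3 (Bernoulli identity,
  principal eigenfunction of `L̄*`, Lemmas 5.3–5.4, Harnack) and Lemma 9.4.

## References

* B. Pineau, V. Vicol, arXiv:2607.09619 (2026), Prop. 9.5 and its proof (p. 32–33), (1.15)–(1.16)
  (p. 8). [PineauVicol2026]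
* J. C. Robinson, J. L. Rodrigo, W. Sadowski, *The Three-Dimensional Navier–Stokes Equations*,
  CUP (2016), proof of Lemma 15.12, pp. 227–229 (the dual device). [RobinsonRodrigoSadowski2016]
* E. M. Stein, *Singular integrals and differentiability properties of functions* (1970),
  Ch. III §1.3, Prop. 3. [Stein1971]
* H. Brezis, *Functional Analysis, Sobolev Spaces and PDE* (2011), Prop. 3.5 / Thm. 4.11
  (duality `(L³)' = L^{3/2}`).
-/

noncomputable section

open MeasureTheory Set Function Filter Metric TopologicalSpace
open _root_.Topology
open scoped ENNReal NNReal InnerProductSpace RealInnerProductSpace Laplacian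

namespace Literature.Analysis.FluidPDE

/-! ### `u ∈ L³` from the Type I bound -/

section TypeI

variable {u : ℝ → EuclideanSpace ℝ (Fin 3) → EuclideanSpace ℝ (Fin 3)} {Cu : ℝ}

/-- `(a + b)³ ≥ a^{1/2} b^{5/2}` for `a, b ≥ 0`, in the form `((a + b)³)⁻¹ ≤ a^{−1/2} b^{−5/2}` for
`a, b > 0`. [folklore] -/
theorem inv_add_pow_three_le_rpow (a b : ℝ) (ha : 0 < a) (hb : 0 < b) :
    ((a + b) ^ 3)⁻¹ ≤ a ^ (-(1 / 2 : ℝ)) * b ^ (-(5 / 2 : ℝ)) := by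
  have hab : 0 < a + b := by positivity
  have h1 : a ^ (1 / 2 : ℝ) ≤ (a + b) ^ (1 / 2 : ℝ) :=
    Real.rpow_le_rpow ha.le (by linarith) (by norm_num)
  have h2 : b ^ (5 / 2 : ℝ) ≤ (a + b) ^ (5 / 2 : ℝ) :=
    Real.rpow_le_rpow hb.le (by linarith) (by norm_num)
  have h3 : a ^ (1 / 2 : ℝ) * b ^ (5 / 2 : ℝ) ≤ (a + b) ^ 3 := by
    calc a ^ (1 / 2 : ℝ) * b ^ (5 / 2 : ℝ) ≤ (a + b) ^ (1 / 2 : ℝ) * (a + b) ^ (5 / 2 : ℝ) :=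
          mul_le_mul h1 h2 (by positivity) (by positivity)
      _ = (a + b) ^ ((1 / 2 : ℝ) + 5 / 2) := (Real.rpow_add hab _ _).symm
      _ = (a + b) ^ 3 := by norm_num
  have h4 : 0 < a ^ (1 / 2 : ℝ) * b ^ (5 / 2 : ℝ) := by positivity
  rw [Real.rpow_neg ha.le, Real.rpow_neg hb.le, ← mul_inv]
  exact inv_anti₀ h4 h3

/-- **Separated Type I majorant for `|u|³`.** Under (1.15), for `t ∈ [−1, 0)` and `0 ≠ x ∈ B₁`,
`|u(t, x)|³ ≤ C_u³ (−t)^{−1/4} |x|^{−5/2}`. [cite: PineauVicol2026, (1.15), arXiv:2607.09619 p. 8] -/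
theorem norm_cube_le_of_typeI
    (hI : ∀ t ∈ Ico (-1 : ℝ) 0, ∀ x ∈ ball (0 : EuclideanSpace ℝ (Fin 3)) 1,
      ‖u t x‖ ≤ Cu / (Real.sqrt (-t) + ‖x‖))
    {t : ℝ} (ht : t ∈ Ico (-1 : ℝ) 0) {x : EuclideanSpace ℝ (Fin 3)} (hx : x ∈ ball 0 1)
    (hx0 : x ≠ 0) :
    ‖u t x‖ ^ 3 ≤ Cu ^ 3 * ((-t) ^ (-(1 / 4 : ℝ)) * ‖x‖ ^ (-(5 / 2 : ℝ))) := by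
  have hCu : 0 ≤ Cu := by
    have h := hI (-(1 / 2 : ℝ)) ⟨by norm_num, by norm_num⟩ 0 (mem_ball_self one_pos)
    rw [norm_zero, add_zero] at h
    have hs : 0 < Real.sqrt (-(-(1 / 2 : ℝ))) := Real.sqrt_pos.2 (by norm_num)
    have h0 : 0 ≤ Cu / Real.sqrt (-(-(1 / 2 : ℝ))) := (norm_nonneg _).trans h
    exact (div_nonneg_iff.1 h0).elim (fun h => h.1) fun h => absurd h.2 (not_le.2 hs)
  have ha : 0 < Real.sqrt (-t) := Real.sqrt_pos.2 (by linarith [ht.2])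
  have hb : 0 < ‖x‖ := norm_pos_iff.2 hx0
  have h1 := hI t ht x hx
  have h2 : ‖u t x‖ ^ 3 ≤ Cu ^ 3 * ((Real.sqrt (-t) + ‖x‖) ^ 3)⁻¹ := by
    calc ‖u t x‖ ^ 3 ≤ (Cu / (Real.sqrt (-t) + ‖x‖)) ^ 3 := pow_le_pow_left₀ (norm_nonneg _) h1 3
      _ = Cu ^ 3 * ((Real.sqrt (-t) + ‖x‖) ^ 3)⁻¹ := by rw [div_pow, div_eq_mul_inv]
  have h3 : (Real.sqrt (-t)) ^ (-(1 / 2 : ℝ)) = (-t) ^ (-(1 / 4 : ℝ)) := by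
    rw [Real.sqrt_eq_rpow, ← Real.rpow_mul (by linarith [ht.2])]
    norm_num
  calc ‖u t x‖ ^ 3 ≤ Cu ^ 3 * ((Real.sqrt (-t) + ‖x‖) ^ 3)⁻¹ := h2
    _ ≤ Cu ^ 3 * ((Real.sqrt (-t)) ^ (-(1 / 2 : ℝ)) * ‖x‖ ^ (-(5 / 2 : ℝ))) :=
        mul_le_mul_of_nonneg_left (inv_add_pow_three_le_rpow _ _ ha hb) (by positivity)
    _ = Cu ^ 3 * ((-t) ^ (-(1 / 4 : ℝ)) * ‖x‖ ^ (-(5 / 2 : ℝ))) := by rw [h3]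

/-- `∫_{−1}^{0} (−t)^{−1/4} dt < ∞` (in `ℝ≥0∞` form). [folklore] -/
theorem lintegral_Ioo_neg_rpow_quarter_lt_top :
    ∫⁻ t in Ioo (-1 : ℝ) 0, ENNReal.ofReal ((-t) ^ (-(1 / 4 : ℝ))) < ⊤ := by
  have h1 : IntegrableOn (fun s : ℝ => s ^ (-(1 / 4 : ℝ))) (Ioo (0 : ℝ) 1) volume := by
    rw [intervalIntegral.integrableOn_Ioo_rpow_iff one_pos]; norm_num
  have h2 : IntegrableOn (fun t : ℝ => (-t) ^ (-(1 / 4 : ℝ))) (Ioo (-1 : ℝ) 0) volume := by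
    have hpre : Neg.neg ⁻¹' Ioo (0 : ℝ) 1 = Ioo (-1 : ℝ) 0 := by
      ext t; simp only [mem_preimage, mem_Ioo]; constructor <;> intro h <;> constructor <;> linarith
    have := ((Measure.measurePreserving_neg (volume : Measure ℝ)).integrableOn_comp_preimage
      (Homeomorph.neg ℝ).measurableEmbedding).2 h1
    rwa [hpre] at this
  calc ∫⁻ t in Ioo (-1 : ℝ) 0, ENNReal.ofReal ((-t) ^ (-(1 / 4 : ℝ)))
      = ∫⁻ t in Ioo (-1 : ℝ) 0, ‖(-t) ^ (-(1 / 4 : ℝ))‖ₑ := by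
        refine setLIntegral_congr_fun measurableSet_Ioo fun t ht => ?_
        rw [Real.enorm_eq_ofReal (Real.rpow_nonneg (by linarith [ht.2]) _)]
    _ < ⊤ := h2.2

/-- `∫_{B₁} |x|^{−5/2} dx < ∞` in `ℝ³` (in `ℝ≥0∞` form). [folklore] -/
theorem lintegral_ball_norm_rpow_lt_top :
    ∫⁻ x in ball (0 : EuclideanSpace ℝ (Fin 3)) 1, ENNReal.ofReal (‖x‖ ^ (-(5 / 2 : ℝ))) < ⊤ := by
  have h1 : IntegrableOn (fun x : EuclideanSpace ℝ (Fin 3) => ‖x‖ ^ (-(5 / 2 : ℝ))) (ball 0 1)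
      volume := by
    refine integrableOn_ball_of_norm_le_rpow (by rw [finrank_euclideanSpace_fin]; norm_num)
      (C := 1) (α := 5 / 2) (by rw [finrank_euclideanSpace_fin]; norm_num)
      (Eventually.of_forall fun y => ?_) ?_
    · rw [Real.norm_of_nonneg (Real.rpow_nonneg (norm_nonneg _) _), one_mul]
    · exact (continuous_norm.measurable.pow_const _).aestronglyMeasurable
  calc ∫⁻ x in ball (0 : EuclideanSpace ℝ (Fin 3)) 1, ENNReal.ofReal (‖x‖ ^ (-(5 / 2 : ℝ)))
      = ∫⁻ x in ball (0 : EuclideanSpace ℝ (Fin 3)) 1, ‖‖x‖ ^ (-(5 / 2 : ℝ))‖ₑ :=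
        lintegral_congr fun x => (Real.enorm_eq_ofReal (Real.rpow_nonneg (norm_nonneg _) _)).symm
    _ < ⊤ := h1.2

/-- **`u ∈ L³((−1, 0) × B₁)` from the Type I bound (1.15), quantitatively** ("from (1.15) …
`u ∈ L³_{x,t}`", proof of Prop. 9.5): `∫∫ |u|³ ≤ C_u³ (∫_{−1}^0 (−t)^{−1/4})(∫_{B₁} |x|^{−5/2})`.
[cite: PineauVicol2026, proof of Prop. 9.5, arXiv:2607.09619 p. 33] -/
theorem lintegral_typeI_cube_le
    (hI : ∀ t ∈ Ico (-1 : ℝ) 0, ∀ x ∈ ball (0 : EuclideanSpace ℝ (Fin 3)) 1,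
      ‖u t x‖ ≤ Cu / (Real.sqrt (-t) + ‖x‖)) :
    ∫⁻ z in Ioo (-1 : ℝ) 0 ×ˢ ball (0 : EuclideanSpace ℝ (Fin 3)) 1,
      ENNReal.ofReal (‖u z.1 z.2‖ ^ 3) ≤
      ENNReal.ofReal (Cu ^ 3) *
        ((∫⁻ t in Ioo (-1 : ℝ) 0, ENNReal.ofReal ((-t) ^ (-(1 / 4 : ℝ)))) *
          ∫⁻ x in ball (0 : EuclideanSpace ℝ (Fin 3)) 1, ENNReal.ofReal (‖x‖ ^ (-(5 / 2 : ℝ)))) := by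
  have hCu : 0 ≤ Cu := by
    have h := hI (-(1 / 2 : ℝ)) ⟨by norm_num, by norm_num⟩ 0 (mem_ball_self one_pos)
    rw [norm_zero, add_zero] at h
    have hs : 0 < Real.sqrt (-(-(1 / 2 : ℝ))) := Real.sqrt_pos.2 (by norm_num)
    have h0 : 0 ≤ Cu / Real.sqrt (-(-(1 / 2 : ℝ))) := (norm_nonneg _).trans h
    exact (div_nonneg_iff.1 h0).elim (fun h => h.1) fun h => absurd h.2 (not_le.2 hs)
  -- a.e. `z.2 ≠ 0`
  have h0 : ∀ᵐ z ∂(volume : Measure (ℝ × EuclideanSpace ℝ (Fin 3))), z.2 ≠ 0 := by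
    rw [ae_iff]
    have hset : {z : ℝ × EuclideanSpace ℝ (Fin 3) | ¬z.2 ≠ 0} = (univ : Set ℝ) ×ˢ {(0 : EuclideanSpace ℝ (Fin 3))} := by
      ext z; simp
    rw [hset, Measure.volume_eq_prod, Measure.prod_prod]
    simp
  -- pointwise bound on the cylinder
  have hle : ∀ᵐ z ∂(volume.restrict (Ioo (-1 : ℝ) 0 ×ˢ ball (0 : EuclideanSpace ℝ (Fin 3)) 1)),
      ENNReal.ofReal (‖u z.1 z.2‖ ^ 3) ≤
        ENNReal.ofReal (Cu ^ 3) * (ENNReal.ofReal ((-z.1) ^ (-(1 / 4 : ℝ))) *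
          ENNReal.ofReal (‖z.2‖ ^ (-(5 / 2 : ℝ)))) := by
    filter_upwards [ae_restrict_mem (measurableSet_Ioo.prod measurableSet_ball),
      ae_restrict_of_ae h0] with z hz hz0
    obtain ⟨ht, hx⟩ := mem_prod.1 hz
    have h := norm_cube_le_of_typeI hI (Ioo_subset_Ico_self ht) hx hz0
    rw [← ENNReal.ofReal_mul (Real.rpow_nonneg (by linarith [ht.2]) _),
      ← ENNReal.ofReal_mul (pow_nonneg hCu 3)]
    exact ENNReal.ofReal_le_ofReal h
  -- integrate: the majorant separates
  have hmT : Measurable fun t : ℝ => ENNReal.ofReal ((-t) ^ (-(1 / 4 : ℝ))) :=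
    (measurable_neg.pow_const _).ennreal_ofReal
  have hmX : Measurable fun x : EuclideanSpace ℝ (Fin 3) => ENNReal.ofReal (‖x‖ ^ (-(5 / 2 : ℝ))) :=
    (continuous_norm.measurable.pow_const _).ennreal_ofReal
  calc ∫⁻ z in Ioo (-1 : ℝ) 0 ×ˢ ball (0 : EuclideanSpace ℝ (Fin 3)) 1, ENNReal.ofReal (‖u z.1 z.2‖ ^ 3)
      ≤ ∫⁻ z in Ioo (-1 : ℝ) 0 ×ˢ ball (0 : EuclideanSpace ℝ (Fin 3)) 1,
          ENNReal.ofReal (Cu ^ 3) * (ENNReal.ofReal ((-z.1) ^ (-(1 / 4 : ℝ))) *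
            ENNReal.ofReal (‖z.2‖ ^ (-(5 / 2 : ℝ)))) := lintegral_mono_ae hle
    _ = ENNReal.ofReal (Cu ^ 3) * ∫⁻ z in Ioo (-1 : ℝ) 0 ×ˢ ball (0 : EuclideanSpace ℝ (Fin 3)) 1,
          ENNReal.ofReal ((-z.1) ^ (-(1 / 4 : ℝ))) * ENNReal.ofReal (‖z.2‖ ^ (-(5 / 2 : ℝ))) := by
        rw [lintegral_const_mul]
        exact (hmT.comp measurable_fst).mul (hmX.comp measurable_snd)
    _ = ENNReal.ofReal (Cu ^ 3) *
          ((∫⁻ t in Ioo (-1 : ℝ) 0, ENNReal.ofReal ((-t) ^ (-(1 / 4 : ℝ)))) *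
            ∫⁻ x in ball (0 : EuclideanSpace ℝ (Fin 3)) 1, ENNReal.ofReal (‖x‖ ^ (-(5 / 2 : ℝ)))) := by
        rw [Measure.volume_eq_prod, ← Measure.prod_restrict,
          lintegral_prod_mul hmT.aemeasurable hmX.aemeasurable]

/-- **`u ∈ L³((−1, 0) × B₁)` from the Type I bound (1.15)**: both factors of the majorant are
finite (exponents `−1/4 > −1` in time and `5/2 < 3` in `ℝ³`). [cite: PineauVicol2026, proof of Prop. 9.5, arXiv:2607.09619 p. 33] -/
theorem lintegral_typeI_cube_lt_top
    (hI : ∀ t ∈ Ico (-1 : ℝ) 0, ∀ x ∈ ball (0 : EuclideanSpace ℝ (Fin 3)) 1,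
      ‖u t x‖ ≤ Cu / (Real.sqrt (-t) + ‖x‖)) :
    ∫⁻ z in Ioo (-1 : ℝ) 0 ×ˢ ball (0 : EuclideanSpace ℝ (Fin 3)) 1,
      ENNReal.ofReal (‖u z.1 z.2‖ ^ 3) < ⊤ :=
  lt_of_le_of_lt (lintegral_typeI_cube_le hI) (ENNReal.mul_lt_top ENNReal.ofReal_lt_top
    (ENNReal.mul_lt_top lintegral_Ioo_neg_rpow_quarter_lt_top lintegral_ball_norm_rpow_lt_top))

end TypeI

/-! ### The dual pressure estimate -/

section HessianPairing

-- nested operator types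
set_option maxSynthPendingDepth 3

/-- **The Hessian pairing `∫ |D²Θ(v, v)|` against a field in `L³`.** If `Θ ∈ C²` is supported
in `N`, and the coordinate second derivatives of `Θ` have `L³` norm at most `S`, then
`∫ |D²Θ(v, v)| ≤ 9 ‖v‖²_{L³(N)} S` (`|D²Θ(v,v)| ≤ |v|² Σᵢⱼ|∂ᵢ∂ⱼΘ|` and Hölder `3/2`–`3`; the
near part of the tree's `RRS2016.lintegral_enorm_hessian_potential_le`). [folklore] -/
theorem lintegral_enorm_hessian_apply_le_of_tsupport_subset {Θ : (EuclideanSpace ℝ (Fin 3)) → ℝ} (hΘ2 : ContDiff ℝ 2 Θ)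
    {N : Set (EuclideanSpace ℝ (Fin 3))} (hsupp : tsupport Θ ⊆ N) {v : (EuclideanSpace ℝ (Fin 3)) → (EuclideanSpace ℝ (Fin 3))}
    (hv : AEStronglyMeasurable v (volume.restrict N)) {S : ℝ≥0∞}
    (hS : ∀ i j : Fin 3,
      eLpNorm (fun x => fderiv ℝ (fun y => fderiv ℝ Θ y (EuclideanSpace.basisFun (Fin 3) ℝ i)) x
        (EuclideanSpace.basisFun (Fin 3) ℝ j)) 3 volume ≤ S) :
    ∫⁻ x, ‖fderiv ℝ (fderiv ℝ Θ) x (v x) (v x)‖ₑ ≤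
      9 * (∫⁻ x in N, ‖v x‖ₑ ^ (3 : ℕ)) ^ (2 / 3 : ℝ) * S := by
  set e := EuclideanSpace.basisFun (Fin 3) ℝ with he
  set Hij : Fin 3 → Fin 3 → (EuclideanSpace ℝ (Fin 3)) → ℝ := fun i j x =>
    fderiv ℝ (fun y => fderiv ℝ Θ y (e i)) x (e j) with hHij
  have hHc : ∀ i j, Continuous (Hij i j) := fun i j => by
    have h1 : ContDiff ℝ 1 (fun y => fderiv ℝ Θ y (e i)) :=
      (hΘ2.fderiv_right (m := 1) le_rfl).clm_apply contDiff_const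
    exact ((h1.fderiv_right (m := 0) le_rfl).clm_apply contDiff_const).continuous
  have hH0 : ∀ i j x, x ∉ tsupport Θ → Hij i j x = 0 := fun i j x hx =>
    RRS2016.fderiv2_dir_eq_zero_of_notMem_tsupport hx _ _
  set F : (EuclideanSpace ℝ (Fin 3)) → ℝ := fun x => fderiv ℝ (fderiv ℝ Θ) x (v x) (v x) with hF
  -- pointwise majorant
  have hFle : ∀ x, ‖F x‖ₑ ≤ ‖v x‖ₑ ^ 2 * ∑ i, ∑ j, ‖Hij i j x‖ₑ := by
    intro x
    have h := abs_fderiv_fderiv_apply_le_norm_sq_mul_sum e hΘ2 x (v x)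
    have hdΘ : DifferentiableAt ℝ (fderiv ℝ Θ) x :=
      ((hΘ2.fderiv_right (m := 1) le_rfl).differentiable one_ne_zero) x
    rw [fderiv_apply_const_apply hdΘ (v x) (v x)] at h
    calc ‖F x‖ₑ = ENNReal.ofReal |F x| := by rw [← Real.norm_eq_abs, ofReal_norm]
      _ ≤ ENNReal.ofReal (‖v x‖ ^ 2 * ∑ i, ∑ j, |Hij i j x|) := ENNReal.ofReal_le_ofReal h
      _ = ‖v x‖ₑ ^ 2 * ∑ i, ∑ j, ‖Hij i j x‖ₑ := by
          rw [ENNReal.ofReal_mul (sq_nonneg _), ENNReal.ofReal_pow (norm_nonneg _), ofReal_norm,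
            ENNReal.ofReal_sum_of_nonneg (fun i _ => Finset.sum_nonneg fun j _ => abs_nonneg _)]
          congr 1
          refine Finset.sum_congr rfl fun i _ => ?_
          rw [ENNReal.ofReal_sum_of_nonneg (fun j _ => abs_nonneg _)]
          refine Finset.sum_congr rfl fun j _ => ?_
          rw [← Real.norm_eq_abs, ofReal_norm]
  have hF0 : ∀ x ∉ N, ‖F x‖ₑ = 0 := by
    intro x hx
    have hxT : x ∉ tsupport Θ := fun h => hx (hsupp h)
    refine le_antisymm ((hFle x).trans (le_of_eq ?_)) zero_le
    simp [hH0 _ _ x hxT]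
  have step0 : ∫⁻ x, ‖F x‖ₑ ≤ ∫⁻ x in N, ‖v x‖ₑ ^ 2 * ∑ i, ∑ j, ‖Hij i j x‖ₑ := by
    calc ∫⁻ x, ‖F x‖ₑ = ∫⁻ x in N, ‖F x‖ₑ := by
          refine (setLIntegral_eq_of_support_subset fun x hx => ?_).symm
          by_contra h
          exact hx (hF0 x h)
      _ ≤ _ := lintegral_mono fun x => hFle x
  have hvN : AEMeasurable (fun x => ‖v x‖ₑ ^ 2) (volume.restrict N) := hv.enorm.pow_const 2
  have hHm : ∀ i j (μ : Measure (EuclideanSpace ℝ (Fin 3))), AEMeasurable (fun x => ‖Hij i j x‖ₑ) μ :=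
    fun i j μ => (hHc i j).measurable.enorm.aemeasurable
  have hpq : Real.HolderConjugate (3 / 2) 3 := Real.holderConjugate_iff.2 ⟨by norm_num, by norm_num⟩
  have e1 : ∫⁻ x in N, ‖v x‖ₑ ^ 2 * ∑ i, ∑ j, ‖Hij i j x‖ₑ =
      ∑ i, ∑ j, ∫⁻ x in N, ‖v x‖ₑ ^ 2 * ‖Hij i j x‖ₑ := by
    have hgm : ∀ i j, AEMeasurable (fun x => ‖v x‖ₑ ^ 2 * ‖Hij i j x‖ₑ) (volume.restrict N) :=
      fun i j => hvN.mul (hHm i j _)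
    simp_rw [Finset.mul_sum]
    rw [lintegral_finsetSum' _ fun i _ => Finset.aemeasurable_fun_sum _ fun j _ => hgm i j]
    exact Finset.sum_congr rfl fun i _ => lintegral_finsetSum' _ fun j _ => hgm i j
  have e2 : ∀ i j, ∫⁻ x in N, ‖v x‖ₑ ^ 2 * ‖Hij i j x‖ₑ ≤
      (∫⁻ x in N, ‖v x‖ₑ ^ (3 : ℕ)) ^ (2 / 3 : ℝ) * S := by
    intro i j
    have h := ENNReal.lintegral_mul_le_Lp_mul_Lq (volume.restrict N) hpq hvN (hHm i j _)
    simp only [RRS2016.ennreal_sq_rpow_threeHalves] at h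
    rw [show (1 : ℝ) / (3 / 2) = 2 / 3 by norm_num] at h
    refine h.trans (mul_le_mul' le_rfl ?_)
    have hst := hS i j
    rw [RRS2016.eLpNorm_three_eq] at hst
    calc (∫⁻ x in N, ‖Hij i j x‖ₑ ^ (3 : ℝ)) ^ (1 / 3 : ℝ)
        ≤ (∫⁻ x, ‖Hij i j x‖ₑ ^ (3 : ℝ)) ^ (1 / 3 : ℝ) := by
          gcongr; exact Measure.restrict_le_self
      _ ≤ S := hst
  calc ∫⁻ x, ‖F x‖ₑ ≤ _ := step0
    _ = _ := e1
    _ ≤ ∑ _i : Fin 3, ∑ _j : Fin 3, (∫⁻ x in N, ‖v x‖ₑ ^ (3 : ℕ)) ^ (2 / 3 : ℝ) * S :=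
        Finset.sum_le_sum fun i _ => Finset.sum_le_sum fun j _ => e2 i j
    _ = 9 * (∫⁻ x in N, ‖v x‖ₑ ^ (3 : ℕ)) ^ (2 / 3 : ℝ) * S := by
        simp only [Finset.sum_const, Finset.card_univ, Fintype.card_fin, nsmul_eq_mul, Nat.cast_ofNat]
        ring

end HessianPairing

section Smoothing

variable {r₀ r₁ r : ℝ} {g : (EuclideanSpace ℝ (Fin 3)) → ℝ}

/-- **The smoothing remainder `Λ^{r₀,r₁}[g]` of a test function supported in `B(0, r)` lives in
the shell `r₀ − r < |x| < r₁ + r`** (`λ` is supported in the annulus `r₀ ≤ |z| ≤ r₁`). [folklore] -/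
theorem newtonFarSmoothing_eq_zero_of_notMem_shell (h₀ : 0 ≤ r₀) (h₁ : r₀ < r₁)
    (hsupp : tsupport g ⊆ ball (0 : (EuclideanSpace ℝ (Fin 3))) r) {x : (EuclideanSpace ℝ (Fin 3))} (hx : ‖x‖ ≤ r₀ - r ∨ r₁ + r ≤ ‖x‖) :
    newtonFarSmoothing r₀ r₁ g x = 0 := by
  rcases hx with hx | hx
  · rw [newtonFarSmoothing_apply]
    refine integral_eq_zero_of_ae (Eventually.of_forall fun z => ?_)
    by_cases hz : ‖z‖ < r₀
    · simp only [newtonFarLaplacian_eq_zero_of_lt h₀ h₁ hz, zero_mul, Pi.zero_apply]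
    · have hg0 : g (x - z) = 0 := by
        refine image_eq_zero_of_notMem_tsupport fun h => ?_
        have hmem := hsupp h
        rw [mem_ball_zero_iff] at hmem
        have : ‖z‖ ≤ ‖x - z‖ + ‖x‖ := by
          calc ‖z‖ = ‖x - (x - z)‖ := by rw [sub_sub_cancel]
            _ ≤ ‖x‖ + ‖x - z‖ := norm_sub_le _ _
            _ = ‖x - z‖ + ‖x‖ := add_comm _ _
        linarith [not_lt.1 hz]
      simp only [hg0, mul_zero, Pi.zero_apply]
  · have hx' : r + r₁ ≤ ‖x - 0‖ := by rw [sub_zero]; linarith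
    exact RRS2016.newtonFarSmoothing_eq_zero_of_far h₀ h₁ hsupp hx'

/-- **`|Λ[g](x)| ≤ ‖λ‖_∞ ‖g‖_{L¹}`.** [folklore] -/
theorem abs_newtonFarSmoothing_le_of_forall_abs_le {M : ℝ}
    (hM : ∀ z, |newtonFarLaplacian r₀ r₁ z| ≤ M) (hg : Continuous g) (hgc : HasCompactSupport g)
    (x : (EuclideanSpace ℝ (Fin 3))) : |newtonFarSmoothing r₀ r₁ g x| ≤ M * ∫ y, |g y| := by
  rw [newtonFarSmoothing_apply]
  have hgi : Integrable g := hg.integrable_of_hasCompactSupport hgc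
  have hgi' : Integrable (fun z => g (x - z)) := hgi.comp_sub_left x
  have hmaj : Integrable (fun z => M * |g (x - z)|) := (hgi'.abs).const_mul M
  calc |∫ z, newtonFarLaplacian r₀ r₁ z * g (x - z)|
      = ‖∫ z, newtonFarLaplacian r₀ r₁ z * g (x - z)‖ := (Real.norm_eq_abs _).symm
    _ ≤ ∫ z, M * |g (x - z)| := by
        refine norm_integral_le_of_norm_le hmaj (Eventually.of_forall fun z => ?_)
        rw [Real.norm_eq_abs, abs_mul]
        exact mul_le_mul_of_nonneg_right (hM z) (abs_nonneg _)
    _ = M * ∫ z, |g (x - z)| := integral_const_mul _ _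
    _ = M * ∫ y, |g y| := by
        congr 1
        exact integral_sub_left_eq_self (fun y => |g y|) volume x

/-- `‖g‖_{L¹} ≤ |B(0,r)|^{2/3} ‖g‖_{L³}` for a test function supported in `B(0, r)` (Hölder).
[folklore] -/
theorem integral_abs_le_measureReal_rpow_mul_eLpNorm_three (hg : Continuous g)
    (hsupp : tsupport g ⊆ ball (0 : (EuclideanSpace ℝ (Fin 3))) r) :
    ∫ y, |g y| ≤ (volume.real (ball (0 : (EuclideanSpace ℝ (Fin 3))) r)) ^ (2 / 3 : ℝ) * (eLpNorm g 3 volume).toReal := by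
  set B : Set (EuclideanSpace ℝ (Fin 3)) := ball (0 : (EuclideanSpace ℝ (Fin 3))) r with hB
  have hgc : HasCompactSupport g := RRS2016.hasCompactSupport_of_tsupport_subset_ball hsupp
  have hgi : Integrable g := hg.integrable_of_hasCompactSupport hgc
  have hg0 : ∀ x ∉ B, g x = 0 := fun x hx =>
    image_eq_zero_of_notMem_tsupport fun h => hx (hsupp h)
  have hBfin : volume B < ⊤ := measure_ball_lt_top
  -- `∫ |g| = ‖g‖_{L¹(B)}`
  have e1 : ENNReal.ofReal (∫ y, |g y|) = eLpNorm g 1 (volume.restrict B) := by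
    rw [eLpNorm_one_eq_lintegral_enorm, ← setIntegral_eq_integral_of_forall_compl_eq_zero
      (fun x hx => by rw [hg0 x hx, abs_zero]),
      ofReal_integral_eq_lintegral_ofReal hgi.abs.integrableOn (ae_of_all _ fun y => abs_nonneg _)]
    refine lintegral_congr fun y => ?_
    rw [← Real.norm_eq_abs, ofReal_norm]
  -- Hölder `1 ≤ 3` on the finite-measure set `B`
  have e2 : eLpNorm g 1 (volume.restrict B) ≤
      eLpNorm g 3 volume * (volume B) ^ (2 / 3 : ℝ) := by
    have h := eLpNorm_le_eLpNorm_mul_rpow_measure_univ (p := 1) (q := 3) (by norm_num)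
      (hg.aestronglyMeasurable (μ := volume.restrict B))
    rw [Measure.restrict_apply_univ, ENNReal.toReal_one,
      show (1 : ℝ) / 1 - 1 / (3 : ℝ≥0∞).toReal = 2 / 3 by norm_num] at h
    refine h.trans (mul_le_mul' (eLpNorm_mono_measure g Measure.restrict_le_self) le_rfl)
  have hfin3 : eLpNorm g 3 volume < ⊤ := (hg.memLp_of_hasCompactSupport hgc).eLpNorm_lt_top
  have hfinr : (volume B) ^ (2 / 3 : ℝ) ≠ ⊤ :=
    ENNReal.rpow_ne_top_of_nonneg (by norm_num) hBfin.ne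
  have h3 : ENNReal.ofReal (∫ y, |g y|) ≤ eLpNorm g 3 volume * (volume B) ^ (2 / 3 : ℝ) := by
    rw [e1]; exact e2
  have h4 := (ENNReal.ofReal_le_iff_le_toReal (ENNReal.mul_ne_top hfin3.ne hfinr)).1 h3
  rw [ENNReal.toReal_mul, ← ENNReal.toReal_rpow, mul_comm] at h4
  exact h4

/-- **The smoothing term of the dual pressure estimate.** For radii `0 < r < r₀ < r₁` there is
`C = C(r₀, r₁, r) ≥ 0` such that for every `π` with `|π| ≤ C_p` on the shell
`r₀ − r < |x| < r₁ + r` and every test function `g` supported in `B(0, r)`,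
`|∫ π Λ^{r₀,r₁}[g]| ≤ C_p C ‖g‖_{L³}`. [folklore] -/
theorem exists_abs_integral_mul_newtonFarSmoothing_le (h₀ : 0 < r₀) (h₁ : r₀ < r₁) (r : ℝ) :
    ∃ C : ℝ, 0 ≤ C ∧ ∀ (π : (EuclideanSpace ℝ (Fin 3)) → ℝ) (Cp : ℝ), 0 ≤ Cp →
      (∀ x : (EuclideanSpace ℝ (Fin 3)), r₀ - r < ‖x‖ → ‖x‖ < r₁ + r → |π x| ≤ Cp) →
      ∀ g : (EuclideanSpace ℝ (Fin 3)) → ℝ, Continuous g → tsupport g ⊆ ball (0 : (EuclideanSpace ℝ (Fin 3))) r →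
        |∫ x, π x * newtonFarSmoothing r₀ r₁ g x| ≤ Cp * C * (eLpNorm g 3 volume).toReal := by
  obtain ⟨M, hM⟩ := (continuous_newtonFarLaplacian h₀ h₁).bounded_above_of_compact_support
    (hasCompactSupport_newtonFarLaplacian h₀.le h₁)
  have hM0 : 0 ≤ M := (norm_nonneg _).trans (hM 0)
  set Sh : Set (EuclideanSpace ℝ (Fin 3)) := {x | r₀ - r < ‖x‖ ∧ ‖x‖ < r₁ + r} with hSh
  have hShsub : Sh ⊆ ball (0 : (EuclideanSpace ℝ (Fin 3))) (r₁ + r) := fun x hx => mem_ball_zero_iff.2 hx.2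
  have hShfin : volume Sh < ⊤ := lt_of_le_of_lt (measure_mono hShsub) measure_ball_lt_top
  set V : ℝ := (volume.real (ball (0 : (EuclideanSpace ℝ (Fin 3))) r)) ^ (2 / 3 : ℝ) with hV
  have hV0 : 0 ≤ V := Real.rpow_nonneg measureReal_nonneg _
  refine ⟨M * V * volume.real Sh, by positivity, fun π Cp hCp hπ g hg hsupp => ?_⟩
  have hgc : HasCompactSupport g := RRS2016.hasCompactSupport_of_tsupport_subset_ball hsupp
  have hΛ0 : ∀ x ∉ Sh, newtonFarSmoothing r₀ r₁ g x = 0 := by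
    intro x hx
    refine newtonFarSmoothing_eq_zero_of_notMem_shell h₀.le h₁ hsupp ?_
    by_contra h
    rw [not_or, not_le, not_le] at h
    exact hx ⟨h.1, h.2⟩
  have hΛb : ∀ x, |newtonFarSmoothing r₀ r₁ g x| ≤ M * ∫ y, |g y| := fun x =>
    abs_newtonFarSmoothing_le_of_forall_abs_le (fun z => (Real.norm_eq_abs _).symm.le.trans (hM z))
      hg hgc x
  have hL1 := integral_abs_le_measureReal_rpow_mul_eLpNorm_three hg hsupp
  have hI0 : 0 ≤ ∫ y, |g y| := integral_nonneg fun y => abs_nonneg _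
  -- restrict to the shell and bound pointwise
  have e1 : ∫ x, π x * newtonFarSmoothing r₀ r₁ g x = ∫ x in Sh, π x * newtonFarSmoothing r₀ r₁ g x :=
    (setIntegral_eq_integral_of_forall_compl_eq_zero fun x hx => by rw [hΛ0 x hx, mul_zero]).symm
  have e2 : ‖∫ x in Sh, π x * newtonFarSmoothing r₀ r₁ g x‖ ≤
      Cp * (M * (V * (eLpNorm g 3 volume).toReal)) * volume.real Sh := by
    refine norm_setIntegral_le_of_norm_le_const hShfin fun x hx => ?_
    rw [norm_mul, Real.norm_eq_abs, Real.norm_eq_abs]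
    refine mul_le_mul (hπ x hx.1 hx.2) ((hΛb x).trans ?_) (abs_nonneg _) hCp
    exact mul_le_mul_of_nonneg_left hL1 hM0
  rw [← Real.norm_eq_abs, e1]
  refine e2.trans (le_of_eq ?_)
  ring

end Smoothing

section Dual

-- nested operator types
set_option maxSynthPendingDepth 3

variable {r₀ r₁ r R : ℝ}

/-- **The dual pressure estimate with a bounded far field.** Let `v, π` be given on `B(0, R)`
with `π ∈ L¹(B(0, R))`, the weak slice pressure equation `∫ π Δψ = -∫ D²ψ(v, v)` for all test
functions `ψ` supported in `B(0, R)`, and `|π| ≤ C_p` on the shell `r₀ − r < |x| < r₁ + r`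
(`r + r₁ < R`). Then for every test function `g` supported in `B(0, r)`,
`|∫ π g| ≤ (9 A ‖v‖²_{L³(B_R)} + C_p C_Λ) ‖g‖_{L³}`: test the pressure equation with the
truncated Newtonian potential `Θ = N^{r₀,r₁}[g]` (supported in `B̄(0, r + r₁)`),
`ΔΘ = g − Λ[g]`, bound the Hessian term by Hölder and the Calderón–Zygmund bound `A` for
`D²N^{r₀,r₁}`, and the smoothing term by the far-field bound (the dual form of the splitting
`p = p_loc + h` of Pineau–Vicol, proof of Prop. 9.5; cf. Robinson–Rodrigo–Sadowski, proof of
Lemma 15.12). [cite: PineauVicol2026, proof of Prop. 9.5, arXiv:2607.09619 p. 33] -/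
theorem abs_integral_mul_test_le_of_slice_identity {A : ℝ≥0}
    (hA : ∀ ⦃g : (EuclideanSpace ℝ (Fin 3)) → ℝ⦄, ContDiff ℝ 2 g → HasCompactSupport g → ∀ a b : (EuclideanSpace ℝ (Fin 3)), ‖a‖ ≤ 1 → ‖b‖ ≤ 1 →
      eLpNorm (fun x => fderiv ℝ (fun y => fderiv ℝ (newtonNearPotential r₀ r₁ g) y a) x b) 3
        volume ≤ A * eLpNorm g 3 volume)
    {CΛ : ℝ} (hCΛ : ∀ (π : (EuclideanSpace ℝ (Fin 3)) → ℝ) (Cp : ℝ), 0 ≤ Cp →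
      (∀ x : (EuclideanSpace ℝ (Fin 3)), r₀ - r < ‖x‖ → ‖x‖ < r₁ + r → |π x| ≤ Cp) →
      ∀ g : (EuclideanSpace ℝ (Fin 3)) → ℝ, Continuous g → tsupport g ⊆ ball (0 : (EuclideanSpace ℝ (Fin 3))) r →
        |∫ x, π x * newtonFarSmoothing r₀ r₁ g x| ≤ Cp * CΛ * (eLpNorm g 3 volume).toReal)
    (h₀ : 0 < r₀) (h₁ : r₀ < r₁) (hR : r + r₁ < R)
    {v : (EuclideanSpace ℝ (Fin 3)) → (EuclideanSpace ℝ (Fin 3))} {π : (EuclideanSpace ℝ (Fin 3)) → ℝ} (hv : AEStronglyMeasurable v (volume.restrict (ball (0 : (EuclideanSpace ℝ (Fin 3))) R)))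
    (hX : ∫⁻ x in ball (0 : (EuclideanSpace ℝ (Fin 3))) R, ‖v x‖ₑ ^ (3 : ℕ) ≠ ⊤)
    (hπ : IntegrableOn π (ball (0 : (EuclideanSpace ℝ (Fin 3))) R) volume)
    {Cp : ℝ} (hCp : 0 ≤ Cp) (hπb : ∀ x : (EuclideanSpace ℝ (Fin 3)), r₀ - r < ‖x‖ → ‖x‖ < r₁ + r → |π x| ≤ Cp)
    (hid : ∀ ψ : (EuclideanSpace ℝ (Fin 3)) → ℝ, ContDiff ℝ (⊤ : ℕ∞) ψ → HasCompactSupport ψ →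
      tsupport ψ ⊆ ball (0 : (EuclideanSpace ℝ (Fin 3))) R →
        ∫ x, π x * Δ ψ x = -∫ x, fderiv ℝ (fderiv ℝ ψ) x (v x) (v x))
    {g : (EuclideanSpace ℝ (Fin 3)) → ℝ} (hg : ContDiff ℝ (⊤ : ℕ∞) g) (hsupp : tsupport g ⊆ ball (0 : (EuclideanSpace ℝ (Fin 3))) r) :
    |∫ x, π x * g x| ≤
      (9 * A * ((∫⁻ x in ball (0 : (EuclideanSpace ℝ (Fin 3))) R, ‖v x‖ₑ ^ (3 : ℕ)) ^ (2 / 3 : ℝ)).toReal + Cp * CΛ) *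
        (eLpNorm g 3 volume).toReal := by
  have hr₁ : 0 < r₁ := h₀.trans h₁
  set Θ := newtonNearPotential r₀ r₁ g with hΘ_def
  set Λ := newtonFarSmoothing r₀ r₁ g with hΛ_def
  have hg2 : ContDiff ℝ 2 g := contDiff_infty.1 hg 2
  have hgc : HasCompactSupport g := RRS2016.hasCompactSupport_of_tsupport_subset_ball hsupp
  have hΘs : ContDiff ℝ (⊤ : ℕ∞) Θ := contDiff_newtonNearPotential_top h₀.le h₁ hg
  have hΘ2 : ContDiff ℝ 2 Θ := contDiff_infty.1 hΘs 2
  have hΘc : HasCompactSupport Θ := hasCompactSupport_newtonNearPotential h₀.le h₁ hgc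
  have hΘsupp : tsupport Θ ⊆ closedBall (0 : (EuclideanSpace ℝ (Fin 3))) (r + r₁) := by
    refine closure_minimal (fun x hx => ?_) isClosed_closedBall
    rw [mem_closedBall, dist_zero_right]
    by_contra h
    refine hx (RRS2016.newtonNearPotential_eq_zero_of_far h₀.le h₁ hsupp ?_)
    rw [sub_zero]
    exact (not_le.1 h).le
  have hΘball : tsupport Θ ⊆ ball (0 : (EuclideanSpace ℝ (Fin 3))) R := hΘsupp.trans (closedBall_subset_ball hR)
  have hΛc : Continuous Λ := continuous_newtonFarSmoothing h₀ h₁ hg.continuous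
  have hΛ0 : ∀ x ∉ closedBall (0 : (EuclideanSpace ℝ (Fin 3))) (r + r₁), Λ x = 0 := fun x hx => by
    rw [mem_closedBall, dist_zero_right, not_le] at hx
    exact newtonFarSmoothing_eq_zero_of_notMem_shell h₀.le h₁ hsupp (Or.inr (by linarith))
  have hg0 : ∀ x ∉ closedBall (0 : (EuclideanSpace ℝ (Fin 3))) (r + r₁), g x = 0 := fun x hx =>
    image_eq_zero_of_notMem_tsupport fun h => hx
      ((hsupp.trans (ball_subset_closedBall.trans (closedBall_subset_closedBall (by linarith)))) h)
  -- integrability of the pairings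
  have hπK : IntegrableOn π (closedBall (0 : (EuclideanSpace ℝ (Fin 3))) (r + r₁)) volume :=
    hπ.mono_set (closedBall_subset_ball hR)
  have hIg : Integrable (fun x => π x * g x) :=
    (integrable_mul_of_eq_zero_off_compact (isCompact_closedBall (0 : (EuclideanSpace ℝ (Fin 3))) (r + r₁)) hg.continuous
      hg0 hπK).congr (Eventually.of_forall fun x => mul_comm _ _)
  have hIΛ : Integrable (fun x => π x * Λ x) :=
    (integrable_mul_of_eq_zero_off_compact (isCompact_closedBall (0 : (EuclideanSpace ℝ (Fin 3))) (r + r₁)) hΛc hΛ0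
      hπK).congr (Eventually.of_forall fun x => mul_comm _ _)
  -- the tested pressure equation and Green's representation
  have htest := hid Θ hΘs hΘc hΘball
  have hΔ : ∀ x, Δ Θ x = g x - Λ x := fun x => laplacian_newtonNearPotential h₀ h₁ hg2 x
  have hsplit : ∫ x, π x * g x = (∫ x, π x * Δ Θ x) + ∫ x, π x * Λ x := by
    have e : (fun x => π x * Δ Θ x) = fun x => π x * g x - π x * Λ x := by
      funext x; rw [hΔ x]; ring
    rw [e, integral_sub hIg hIΛ, sub_add_cancel]
  -- the Hessian term
  set X : ℝ≥0∞ := ∫⁻ x in ball (0 : (EuclideanSpace ℝ (Fin 3))) R, ‖v x‖ₑ ^ (3 : ℕ) with hX_def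
  have hS : ∀ i j : Fin 3,
      eLpNorm (fun x => fderiv ℝ (fun y => fderiv ℝ Θ y (EuclideanSpace.basisFun (Fin 3) ℝ i)) x
        (EuclideanSpace.basisFun (Fin 3) ℝ j)) 3 volume ≤ A * eLpNorm g 3 volume := by
    intro i j
    have hi : ‖EuclideanSpace.basisFun (Fin 3) ℝ i‖ ≤ 1 :=
      ((EuclideanSpace.basisFun (Fin 3) ℝ).orthonormal.1 i).le
    have hj : ‖EuclideanSpace.basisFun (Fin 3) ℝ j‖ ≤ 1 :=
      ((EuclideanSpace.basisFun (Fin 3) ℝ).orthonormal.1 j).le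
    exact hA hg2 hgc _ _ hi hj
  have hH := lintegral_enorm_hessian_apply_le_of_tsupport_subset hΘ2 hΘball hv hS
  have hg3 : eLpNorm g 3 volume < ⊤ :=
    (hg.continuous.memLp_of_hasCompactSupport hgc).eLpNorm_lt_top
  have hX23 : X ^ (2 / 3 : ℝ) ≠ ⊤ := ENNReal.rpow_ne_top_of_nonneg (by norm_num) hX
  have hRHS : 9 * X ^ (2 / 3 : ℝ) * (A * eLpNorm g 3 volume) ≠ ⊤ :=
    ENNReal.mul_ne_top (ENNReal.mul_ne_top (by norm_num) hX23)
      (ENNReal.mul_ne_top ENNReal.coe_ne_top hg3.ne)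
  have hHreal : |∫ x, fderiv ℝ (fderiv ℝ Θ) x (v x) (v x)| ≤
      9 * A * (X ^ (2 / 3 : ℝ)).toReal * (eLpNorm g 3 volume).toReal := by
    have h1 : ENNReal.ofReal |∫ x, fderiv ℝ (fderiv ℝ Θ) x (v x) (v x)| ≤
        9 * X ^ (2 / 3 : ℝ) * (A * eLpNorm g 3 volume) := by
      refine le_trans ?_ hH
      rw [← Real.enorm_eq_ofReal_abs]
      exact enorm_integral_le_lintegral_enorm _
    have h2 := (ENNReal.ofReal_le_iff_le_toReal hRHS).1 h1
    refine h2.trans (le_of_eq ?_)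
    rw [ENNReal.toReal_mul, ENNReal.toReal_mul, ENNReal.toReal_mul, ENNReal.coe_toReal]
    norm_num
    ring
  -- the smoothing term
  have hΛreal : |∫ x, π x * Λ x| ≤ Cp * CΛ * (eLpNorm g 3 volume).toReal :=
    hCΛ π Cp hCp hπb g hg.continuous hsupp
  -- assemble
  rw [hsplit, htest]
  calc |-(∫ x, fderiv ℝ (fderiv ℝ Θ) x (v x) (v x)) + ∫ x, π x * Λ x|
      ≤ |-(∫ x, fderiv ℝ (fderiv ℝ Θ) x (v x) (v x))| + |∫ x, π x * Λ x| := abs_add_le _ _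
    _ = |∫ x, fderiv ℝ (fderiv ℝ Θ) x (v x) (v x)| + |∫ x, π x * Λ x| := by rw [abs_neg]
    _ ≤ 9 * A * (X ^ (2 / 3 : ℝ)).toReal * (eLpNorm g 3 volume).toReal +
          Cp * CΛ * (eLpNorm g 3 volume).toReal := add_le_add hHreal hΛreal
    _ = _ := by ring

/-- **Duality**: a bound `|∫ π g| ≤ K ‖g‖_{L³}` for all test functions `g` supported in the
ball `B(0, r)`, with `π ∈ L¹(B(0, r))`, gives `∫_{B(0,r)} |π|^{3/2} ≤ K^{3/2}` (the easy half
of `(L³)' = L^{3/2}`, tree `FunctionSpaces.lintegral_rpow_enorm_le_of_forall_test`). [folklore] -/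
theorem lintegral_ball_enorm_rpow_threeHalves_le_of_forall_test {π : (EuclideanSpace ℝ (Fin 3)) → ℝ} {K : ℝ}
    (hK : 0 ≤ K) (hπ : IntegrableOn π (ball (0 : (EuclideanSpace ℝ (Fin 3))) r) volume)
    (h : ∀ g : (EuclideanSpace ℝ (Fin 3)) → ℝ, ContDiff ℝ (⊤ : ℕ∞) g → HasCompactSupport g →
      tsupport g ⊆ ball (0 : (EuclideanSpace ℝ (Fin 3))) r → |∫ x, π x * g x| ≤ K * (eLpNorm g 3 volume).toReal) :
    ∫⁻ x in ball (0 : (EuclideanSpace ℝ (Fin 3))) r, ‖π x‖ₑ ^ (3 / 2 : ℝ) ≤ ENNReal.ofReal (K ^ (3 / 2 : ℝ)) := by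
  have hpq : (3 / 2 : ℝ).HolderConjugate 3 := Real.holderConjugate_iff.2 ⟨by norm_num, by norm_num⟩
  refine FunctionSpaces.lintegral_rpow_enorm_le_of_forall_test isOpen_ball hπ hpq hK
    fun Ψ hΨ hΨc hΨs => ?_
  have e1 : ∫ x in ball (0 : (EuclideanSpace ℝ (Fin 3))) r, π x * Ψ x = ∫ x, π x * Ψ x :=
    setIntegral_eq_integral_of_forall_compl_eq_zero fun x hx => by
      rw [image_eq_zero_of_notMem_tsupport fun h' => hx (hΨs h'), mul_zero]
  have e3 : ENNReal.ofReal 3 = (3 : ℝ≥0∞) := by norm_num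
  rw [e1, e3]
  exact h Ψ hΨ hΨc hΨs

end Dual

/-! ### The pressure class of the solutions of Theorem 1.9 -/

section Slices

-- nested operator types
set_option maxSynthPendingDepth 3

variable {u : ℝ → (EuclideanSpace ℝ (Fin 3)) → (EuclideanSpace ℝ (Fin 3))} {p : ℝ → (EuclideanSpace ℝ (Fin 3)) → ℝ} {Cu Cp c : ℝ}

/-- The constant of (1.16) is nonnegative (evaluate at a point of the annulus). [folklore] -/
theorem pineauVicol_annulusConst_nonneg
    (hP : ∀ t ∈ Ico (-1 : ℝ) 0, ∀ x : (EuclideanSpace ℝ (Fin 3)), 1 / 2 < ‖x‖ → ‖x‖ < 3 / 4 → |p t x| ≤ Cp) :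
    0 ≤ Cp := by
  set e : (EuclideanSpace ℝ (Fin 3)) := EuclideanSpace.basisFun (Fin 3) ℝ 0 with he_def
  have he : ‖e‖ = 1 := (EuclideanSpace.basisFun (Fin 3) ℝ).orthonormal.1 0
  set x₀ : (EuclideanSpace ℝ (Fin 3)) := (5 / 8 : ℝ) • e with hx₀
  have hn : ‖x₀‖ = 5 / 8 := by
    rw [hx₀, norm_smul, he, mul_one, Real.norm_of_nonneg (by norm_num)]
  exact (abs_nonneg _).trans
    (hP (-(1 / 2 : ℝ)) ⟨by norm_num, by norm_num⟩ x₀ (by rw [hn]; norm_num) (by rw [hn]; norm_num))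

/-- `(9a X^{2/3} + b)^{3/2} ≤ √2 (9a)^{3/2} X + √2 b^{3/2}` in `ℝ≥0∞` (convexity of `s ↦ s^{3/2}`).
[folklore] -/
theorem ofReal_rpow_threeHalves_le (a b : ℝ) (ha : 0 ≤ a) (hb : 0 ≤ b) {X : ℝ≥0∞} (hX : X ≠ ⊤) :
    ENNReal.ofReal ((a * (X ^ (2 / 3 : ℝ)).toReal + b) ^ (3 / 2 : ℝ)) ≤
      (2 : ℝ≥0∞) ^ (1 / 2 : ℝ) * (ENNReal.ofReal a) ^ (3 / 2 : ℝ) * X +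
        (2 : ℝ≥0∞) ^ (1 / 2 : ℝ) * (ENNReal.ofReal b) ^ (3 / 2 : ℝ) := by
  have hX23 : X ^ (2 / 3 : ℝ) ≠ ⊤ := ENNReal.rpow_ne_top_of_nonneg (by norm_num) hX
  have h0 : 0 ≤ a * (X ^ (2 / 3 : ℝ)).toReal := by positivity
  rw [← ENNReal.ofReal_rpow_of_nonneg (by positivity) (by norm_num), ENNReal.ofReal_add h0 hb,
    ENNReal.ofReal_mul ha, ENNReal.ofReal_toReal hX23]
  have hconv := ENNReal.rpow_add_le_mul_rpow_add_rpow (ENNReal.ofReal a * X ^ (2 / 3 : ℝ))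
    (ENNReal.ofReal b) (by norm_num : (1 : ℝ) ≤ 3 / 2)
  rw [show (3 / 2 : ℝ) - 1 = 1 / 2 by norm_num] at hconv
  refine hconv.trans (le_of_eq ?_)
  rw [ENNReal.mul_rpow_of_nonneg _ _ (by norm_num : (0 : ℝ) ≤ 3 / 2), ← ENNReal.rpow_mul,
    show (2 / 3 : ℝ) * (3 / 2) = 1 by norm_num, ENNReal.rpow_one]
  ring

/-- **The slice pressure bound for the solutions of Theorem 1.9.** There is an absolute constant
`C₁` and, for every `C_p`, a constant `C₂ = C₂(C_p)` such that every classical solution on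
`[−1,0) × B₁` with the annular pressure bound (1.16) satisfies, for every `−1 < t < 0`,
`∫_{B_{1/32}} |p(t)|^{3/2} ≤ C₁ ∫_{B_{3/4}} |u(t)|³ + C₂` (the dual estimate at the radii
`(r₀, r₁, r, R) = (9/16, 11/16, 1/32, 3/4)`, and duality); the constants are fixed before the
solution. [cite: PineauVicol2026, proof of Prop. 9.5, arXiv:2607.09619 p. 33] -/
theorem exists_forall_lintegral_ball_pressure_rpow_le :
    ∃ C₁ : ℝ≥0, ∀ Cp : ℝ, ∃ C₂ : ℝ≥0, ∀ (u : ℝ → (EuclideanSpace ℝ (Fin 3)) → (EuclideanSpace ℝ (Fin 3))) (p : ℝ → (EuclideanSpace ℝ (Fin 3)) → ℝ),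
      IsClassicalNSSolutionOnRegion (Ico (-1 : ℝ) 0 ×ˢ ball (0 : (EuclideanSpace ℝ (Fin 3))) 1) 1 0 u p →
      (∀ t ∈ Ico (-1 : ℝ) 0, ∀ x : (EuclideanSpace ℝ (Fin 3)), 1 / 2 < ‖x‖ → ‖x‖ < 3 / 4 → |p t x| ≤ Cp) →
      ∀ t ∈ Ioo (-1 : ℝ) 0,
        ∫⁻ x in ball (0 : (EuclideanSpace ℝ (Fin 3))) (1 / 32), ‖p t x‖ₑ ^ (3 / 2 : ℝ) ≤
          C₁ * (∫⁻ x in ball (0 : (EuclideanSpace ℝ (Fin 3))) (3 / 4), ‖u t x‖ₑ ^ (3 : ℕ)) + C₂ := by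
  -- radii
  have h₀ : (0 : ℝ) < 9 / 16 := by norm_num
  have h₁ : (9 / 16 : ℝ) < 11 / 16 := by norm_num
  have hR : (1 / 32 : ℝ) + 11 / 16 < 3 / 4 := by norm_num
  -- the Calderón–Zygmund constant at these radii
  obtain ⟨A, hA⟩ := stein1970_hessian_Lp_bound_holds_fin3.hessian_newtonNearPotential
    (p := 3) (by norm_num) (by simp)
  have hlam : ∫⁻ z, ‖newtonFarLaplacian (9 / 16) (11 / 16) z‖ₑ < ⊤ :=
    (integrable_newtonFarLaplacian h₀ h₁).2
  set A' : ℝ≥0 := A * (1 + (∫⁻ z, ‖newtonFarLaplacian (9 / 16) (11 / 16) z‖ₑ).toNNReal) with hA'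
  have hA'' : ∀ ⦃g : (EuclideanSpace ℝ (Fin 3)) → ℝ⦄, ContDiff ℝ 2 g → HasCompactSupport g → ∀ a b : (EuclideanSpace ℝ (Fin 3)), ‖a‖ ≤ 1 →
      ‖b‖ ≤ 1 →
      eLpNorm (fun x => fderiv ℝ (fun y => fderiv ℝ (newtonNearPotential (9 / 16) (11 / 16) g) y a)
        x b) 3 volume ≤ A' * eLpNorm g 3 volume := by
    intro g hg hgc a b ha hb
    refine (hA h₀ h₁ hg hgc a b ha hb).trans (le_of_eq ?_)
    rw [hA', ENNReal.coe_mul, ENNReal.coe_add, ENNReal.coe_one, ENNReal.coe_toNNReal hlam.ne,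
      mul_assoc]
  -- the smoothing constant
  obtain ⟨CΛ, hCΛ0, hCΛ⟩ := exists_abs_integral_mul_newtonFarSmoothing_le h₀ h₁ (1 / 32 : ℝ)
  -- the constants
  have h2top : (2 : ℝ≥0∞) ^ (1 / 2 : ℝ) ≠ ⊤ := ENNReal.rpow_ne_top_of_nonneg (by norm_num) (by simp)
  set a : ℝ := 9 * A' with ha_def
  have ha0 : 0 ≤ a := by positivity
  set C₁ : ℝ≥0∞ := (2 : ℝ≥0∞) ^ (1 / 2 : ℝ) * (ENNReal.ofReal a) ^ (3 / 2 : ℝ) with hC₁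
  have hC₁top : C₁ ≠ ⊤ :=
    ENNReal.mul_ne_top h2top (ENNReal.rpow_ne_top_of_nonneg (by norm_num) ENNReal.ofReal_ne_top)
  refine ⟨C₁.toNNReal, fun Cp => ?_⟩
  set b : ℝ := Cp * CΛ with hb_def
  set C₂ : ℝ≥0∞ := (2 : ℝ≥0∞) ^ (1 / 2 : ℝ) * (ENNReal.ofReal b) ^ (3 / 2 : ℝ) with hC₂
  have hC₂top : C₂ ≠ ⊤ :=
    ENNReal.mul_ne_top h2top (ENNReal.rpow_ne_top_of_nonneg (by norm_num) ENNReal.ofReal_ne_top)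
  refine ⟨C₂.toNNReal, fun u p hreg hP t ht => ?_⟩
  rw [ENNReal.coe_toNNReal hC₁top, ENNReal.coe_toNNReal hC₂top]
  have hCp : 0 ≤ Cp := pineauVicol_annulusConst_nonneg hP
  have hb0 : 0 ≤ b := by positivity
  have htI : t ∈ Ico (-1 : ℝ) 0 := Ioo_subset_Ico_self ht
  -- smoothness of the slices on the unit ball
  have hsec : spaceSection (Ico (-1 : ℝ) 0 ×ˢ ball (0 : (EuclideanSpace ℝ (Fin 3))) 1) t = ball 0 1 :=
    spaceSection_prod htI _
  have hu := hreg.contDiffOn_velocity t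
  have hp := hreg.contDiffOn_pressure t
  rw [hsec] at hu hp
  have hsub : closedBall (0 : (EuclideanSpace ℝ (Fin 3))) (3 / 4) ⊆ ball 0 1 := closedBall_subset_ball (by norm_num)
  have huc : ContinuousOn (u t) (closedBall 0 (3 / 4)) := hu.continuousOn.mono hsub
  have hpc : ContinuousOn (p t) (closedBall 0 (3 / 4)) := hp.continuousOn.mono hsub
  have hv : AEStronglyMeasurable (u t) (volume.restrict (ball (0 : (EuclideanSpace ℝ (Fin 3))) (3 / 4))) :=
    (huc.mono ball_subset_closedBall).aestronglyMeasurable measurableSet_ball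
  set X : ℝ≥0∞ := ∫⁻ x in ball (0 : (EuclideanSpace ℝ (Fin 3))) (3 / 4), ‖u t x‖ₑ ^ (3 : ℕ) with hX_def
  have hX : X ≠ ⊤ := by
    obtain ⟨M, hM⟩ := (isCompact_closedBall (0 : (EuclideanSpace ℝ (Fin 3))) (3 / 4)).exists_bound_of_continuousOn huc
    have hle : X ≤ ∫⁻ _ in ball (0 : (EuclideanSpace ℝ (Fin 3))) (3 / 4), ENNReal.ofReal M ^ (3 : ℕ) := by
      refine setLIntegral_mono' measurableSet_ball fun x hx => ?_
      gcongr
      rw [← ofReal_norm]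
      exact ENNReal.ofReal_le_ofReal (hM x (ball_subset_closedBall hx))
    refine ne_top_of_le_ne_top ?_ hle
    rw [setLIntegral_const]
    exact ENNReal.mul_ne_top (ENNReal.pow_ne_top ENNReal.ofReal_ne_top) measure_ball_lt_top.ne
  have hπ : IntegrableOn (p t) (ball (0 : (EuclideanSpace ℝ (Fin 3))) (3 / 4)) volume :=
    (hpc.integrableOn_compact (isCompact_closedBall _ _)).mono_set ball_subset_closedBall
  have hπb : ∀ x : (EuclideanSpace ℝ (Fin 3)), 9 / 16 - 1 / 32 < ‖x‖ → ‖x‖ < 11 / 16 + 1 / 32 → |p t x| ≤ Cp :=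
    fun x hx1 hx2 => hP t htI x (by linarith) (by linarith)
  -- the weak slice pressure equation on `B_{3/4}`
  have hO : IsOpen (Ioo (-1 : ℝ) 0 ×ˢ ball (0 : (EuclideanSpace ℝ (Fin 3))) 1) := isOpen_Ioo.prod isOpen_ball
  have hreg' := hreg.mono_of_isOpen (prod_mono Ioo_subset_Ico_self Subset.rfl) hO
  have hid : ∀ ψ : (EuclideanSpace ℝ (Fin 3)) → ℝ, ContDiff ℝ (⊤ : ℕ∞) ψ → HasCompactSupport ψ →
      tsupport ψ ⊆ ball (0 : (EuclideanSpace ℝ (Fin 3))) (3 / 4) →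
        ∫ x, p t x * Δ ψ x = -∫ x, fderiv ℝ (fderiv ℝ ψ) x (u t x) (u t x) :=
    fun ψ hψ hψc hψs => integral_pressure_mul_laplacian_test hO hreg' hψ hψc fun x hx =>
      mk_mem_prod ht (ball_subset_ball (by norm_num) (hψs hx))
  -- the dual estimate for all test functions on `B_{1/32}`, and duality
  set K : ℝ := a * (X ^ (2 / 3 : ℝ)).toReal + b with hK
  have hK0 : 0 ≤ K := by positivity
  have hdual : ∀ g : (EuclideanSpace ℝ (Fin 3)) → ℝ, ContDiff ℝ (⊤ : ℕ∞) g → HasCompactSupport g →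
      tsupport g ⊆ ball (0 : (EuclideanSpace ℝ (Fin 3))) (1 / 32) → |∫ x, p t x * g x| ≤ K * (eLpNorm g 3 volume).toReal := by
    intro g hg _ hgs
    have h := abs_integral_mul_test_le_of_slice_identity hA'' hCΛ h₀ h₁ hR hv hX hπ hCp hπb hid
      hg hgs
    rw [hK, ha_def, hb_def]
    exact h
  have hπ' : IntegrableOn (p t) (ball (0 : (EuclideanSpace ℝ (Fin 3))) (1 / 32)) volume :=
    hπ.mono_set (ball_subset_ball (by norm_num))
  have hmain := lintegral_ball_enorm_rpow_threeHalves_le_of_forall_test hK0 hπ' hdual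
  exact hmain.trans (ofReal_rpow_threeHalves_le a b ha0 hb0 hX)

/-- **`p ∈ L^{3/2}((−1, 0) × B_{1/32})` for the solutions of Theorem 1.9, quantitatively**:
for all `C_u, C_p` there is `B = B(C_u, C_p)` with `∫∫_{(−1,0) × B_{1/32}} |p|^{3/2} ≤ B` for every
classical solution on `[−1,0) × B₁` with (1.15)–(1.16) (Tonelli, the slice bound, and the Type I
bound `∫∫_{(−1,0)×B₁} |u|³ ≤ C C_u³`). [cite: PineauVicol2026, proof of Prop. 9.5, arXiv:2607.09619 p. 33] -/
theorem exists_lintegral_pressure_rpow_threeHalves_le (Cu Cp : ℝ) :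
    ∃ B : ℝ≥0, ∀ (u : ℝ → (EuclideanSpace ℝ (Fin 3)) → (EuclideanSpace ℝ (Fin 3))) (p : ℝ → (EuclideanSpace ℝ (Fin 3)) → ℝ),
      IsClassicalNSSolutionOnRegion (Ico (-1 : ℝ) 0 ×ˢ ball (0 : (EuclideanSpace ℝ (Fin 3))) 1) 1 0 u p →
      (∀ t ∈ Ico (-1 : ℝ) 0, ∀ x ∈ ball (0 : (EuclideanSpace ℝ (Fin 3))) 1, ‖u t x‖ ≤ Cu / (Real.sqrt (-t) + ‖x‖)) →
      (∀ t ∈ Ico (-1 : ℝ) 0, ∀ x : (EuclideanSpace ℝ (Fin 3)), 1 / 2 < ‖x‖ → ‖x‖ < 3 / 4 → |p t x| ≤ Cp) →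
      ∫⁻ z in Ioo (-1 : ℝ) 0 ×ˢ ball (0 : (EuclideanSpace ℝ (Fin 3))) (1 / 32), ‖p z.1 z.2‖ₑ ^ (3 / 2 : ℝ) ≤ B := by
  obtain ⟨C₁, hC₁⟩ := exists_forall_lintegral_ball_pressure_rpow_le
  obtain ⟨C₂, hC⟩ := hC₁ Cp
  -- the Type I majorant constants
  set T : ℝ≥0∞ := ∫⁻ t in Ioo (-1 : ℝ) 0, ENNReal.ofReal ((-t) ^ (-(1 / 4 : ℝ))) with hT
  set Xc : ℝ≥0∞ := ∫⁻ x in ball (0 : (EuclideanSpace ℝ (Fin 3))) 1, ENNReal.ofReal (‖x‖ ^ (-(5 / 2 : ℝ))) with hXc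
  set B : ℝ≥0∞ := C₁ * (ENNReal.ofReal (Cu ^ 3) * (T * Xc)) + C₂ * 1 with hB
  have hBtop : B ≠ ⊤ := by
    refine ENNReal.add_ne_top.2 ⟨ENNReal.mul_ne_top ENNReal.coe_ne_top
      (ENNReal.mul_ne_top ENNReal.ofReal_ne_top (ENNReal.mul_ne_top
        lintegral_Ioo_neg_rpow_quarter_lt_top.ne lintegral_ball_norm_rpow_lt_top.ne)), ?_⟩
    exact ENNReal.mul_ne_top ENNReal.coe_ne_top ENNReal.one_ne_top
  refine ⟨B.toNNReal, fun u p hreg hI hP => ?_⟩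
  rw [ENNReal.coe_toNNReal hBtop]
  -- measurability
  have hpc : ContinuousOn (uncurry p) (Ioo (-1 : ℝ) 0 ×ˢ ball (0 : (EuclideanSpace ℝ (Fin 3))) (1 / 32)) :=
    hreg.smooth_pressure.continuousOn.mono
      (prod_mono Ioo_subset_Ico_self (ball_subset_ball (by norm_num)))
  have huc : ContinuousOn (uncurry u) (Ioo (-1 : ℝ) 0 ×ˢ ball (0 : (EuclideanSpace ℝ (Fin 3))) (3 / 4)) :=
    hreg.smooth_velocity.continuousOn.mono
      (prod_mono Ioo_subset_Ico_self (ball_subset_ball (by norm_num)))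
  have hpm : AEMeasurable (fun z : ℝ × (EuclideanSpace ℝ (Fin 3)) => ‖p z.1 z.2‖ₑ ^ (3 / 2 : ℝ))
      ((volume.restrict (Ioo (-1 : ℝ) 0)).prod (volume.restrict (ball (0 : (EuclideanSpace ℝ (Fin 3))) (1 / 32)))) := by
    rw [Measure.prod_restrict, ← Measure.volume_eq_prod]
    exact (hpc.aestronglyMeasurable (measurableSet_Ioo.prod measurableSet_ball)).enorm.pow_const _
  have hum : AEMeasurable (fun z : ℝ × (EuclideanSpace ℝ (Fin 3)) => ‖u z.1 z.2‖ₑ ^ (3 : ℕ))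
      ((volume.restrict (Ioo (-1 : ℝ) 0)).prod (volume.restrict (ball (0 : (EuclideanSpace ℝ (Fin 3))) (3 / 4)))) := by
    rw [Measure.prod_restrict, ← Measure.volume_eq_prod]
    exact (huc.aestronglyMeasurable (measurableSet_Ioo.prod measurableSet_ball)).enorm.pow_const _
  -- Tonelli
  have e1 : ∫⁻ z in Ioo (-1 : ℝ) 0 ×ˢ ball (0 : (EuclideanSpace ℝ (Fin 3))) (1 / 32), ‖p z.1 z.2‖ₑ ^ (3 / 2 : ℝ) =
      ∫⁻ t in Ioo (-1 : ℝ) 0, ∫⁻ x in ball (0 : (EuclideanSpace ℝ (Fin 3))) (1 / 32), ‖p t x‖ₑ ^ (3 / 2 : ℝ) := by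
    rw [Measure.volume_eq_prod, ← Measure.prod_restrict, lintegral_prod _ hpm]
  have e2 : ∫⁻ t in Ioo (-1 : ℝ) 0, ∫⁻ x in ball (0 : (EuclideanSpace ℝ (Fin 3))) (3 / 4), ‖u t x‖ₑ ^ (3 : ℕ) =
      ∫⁻ z in Ioo (-1 : ℝ) 0 ×ˢ ball (0 : (EuclideanSpace ℝ (Fin 3))) (3 / 4), ‖u z.1 z.2‖ₑ ^ (3 : ℕ) := by
    rw [Measure.volume_eq_prod, ← Measure.prod_restrict, lintegral_prod _ hum]
  have hu3 : ∫⁻ z in Ioo (-1 : ℝ) 0 ×ˢ ball (0 : (EuclideanSpace ℝ (Fin 3))) (3 / 4), ‖u z.1 z.2‖ₑ ^ (3 : ℕ) ≤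
      ENNReal.ofReal (Cu ^ 3) * (T * Xc) := by
    refine le_trans
      (lintegral_mono_set (prod_mono Subset.rfl (ball_subset_ball (by norm_num : (3 / 4 : ℝ) ≤ 1)))) ?_
    refine le_trans (le_of_eq (lintegral_congr fun z => ?_)) (lintegral_typeI_cube_le hI)
    rw [← ofReal_norm, ENNReal.ofReal_pow (norm_nonneg _)]
  rw [e1]
  calc ∫⁻ t in Ioo (-1 : ℝ) 0, ∫⁻ x in ball (0 : (EuclideanSpace ℝ (Fin 3))) (1 / 32), ‖p t x‖ₑ ^ (3 / 2 : ℝ)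
      ≤ ∫⁻ t in Ioo (-1 : ℝ) 0,
          ((C₁ : ℝ≥0∞) * (∫⁻ x in ball (0 : (EuclideanSpace ℝ (Fin 3))) (3 / 4), ‖u t x‖ₑ ^ (3 : ℕ)) + C₂) :=
        setLIntegral_mono' measurableSet_Ioo fun t ht => hC u p hreg hP t ht
    _ = C₁ * (∫⁻ t in Ioo (-1 : ℝ) 0, ∫⁻ x in ball (0 : (EuclideanSpace ℝ (Fin 3))) (3 / 4), ‖u t x‖ₑ ^ (3 : ℕ)) +
          C₂ * volume (Ioo (-1 : ℝ) 0) := by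
        rw [lintegral_add_right _ measurable_const, lintegral_const_mul' _ _ ENNReal.coe_ne_top,
          setLIntegral_const]
    _ ≤ B := by
        rw [e2, Real.volume_Ioo, show ENNReal.ofReal (0 - -1) = 1 by simp, hB]
        gcongr

/-- **`p ∈ L^{3/2}((−1, 0) × B_{1/32})` for the solutions of Theorem 1.9.** [cite: PineauVicol2026, proof of Prop. 9.5, arXiv:2607.09619 p. 33] -/
theorem lintegral_pressure_rpow_threeHalves_lt_top
    (hreg : IsClassicalNSSolutionOnRegion (Ico (-1 : ℝ) 0 ×ˢ ball (0 : (EuclideanSpace ℝ (Fin 3))) 1) 1 0 u p)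
    (hI : ∀ t ∈ Ico (-1 : ℝ) 0, ∀ x ∈ ball (0 : (EuclideanSpace ℝ (Fin 3))) 1, ‖u t x‖ ≤ Cu / (Real.sqrt (-t) + ‖x‖))
    (hP : ∀ t ∈ Ico (-1 : ℝ) 0, ∀ x : (EuclideanSpace ℝ (Fin 3)), 1 / 2 < ‖x‖ → ‖x‖ < 3 / 4 → |p t x| ≤ Cp) :
    ∫⁻ z in Ioo (-1 : ℝ) 0 ×ˢ ball (0 : (EuclideanSpace ℝ (Fin 3))) (1 / 32), ‖p z.1 z.2‖ₑ ^ (3 / 2 : ℝ) < ⊤ := by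
  obtain ⟨B, hB⟩ := exists_lintegral_pressure_rpow_threeHalves_le Cu Cp
  exact lt_of_le_of_lt (hB u p hreg hI hP) ENNReal.coe_lt_top

/-- **`p ∈ L^{3/2}((−1, 0) × B_{1/32})`**, `MemLp` form. [cite: PineauVicol2026, proof of Prop. 9.5, arXiv:2607.09619 p. 33] -/
theorem memLp_pressure_threeHalves
    (hreg : IsClassicalNSSolutionOnRegion (Ico (-1 : ℝ) 0 ×ˢ ball (0 : (EuclideanSpace ℝ (Fin 3))) 1) 1 0 u p)
    (hI : ∀ t ∈ Ico (-1 : ℝ) 0, ∀ x ∈ ball (0 : (EuclideanSpace ℝ (Fin 3))) 1, ‖u t x‖ ≤ Cu / (Real.sqrt (-t) + ‖x‖))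
    (hP : ∀ t ∈ Ico (-1 : ℝ) 0, ∀ x : (EuclideanSpace ℝ (Fin 3)), 1 / 2 < ‖x‖ → ‖x‖ < 3 / 4 → |p t x| ≤ Cp) :
    MemLp (uncurry p) (3 / 2) (volume.restrict (Ioo (-1 : ℝ) 0 ×ˢ ball (0 : (EuclideanSpace ℝ (Fin 3))) (1 / 32))) := by
  have hpc : ContinuousOn (uncurry p) (Ioo (-1 : ℝ) 0 ×ˢ ball (0 : (EuclideanSpace ℝ (Fin 3))) (1 / 32)) :=
    hreg.smooth_pressure.continuousOn.mono
      (prod_mono Ioo_subset_Ico_self (ball_subset_ball (by norm_num)))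
  refine ⟨hpc.aestronglyMeasurable (measurableSet_Ioo.prod measurableSet_ball), ?_⟩
  have hp0 : (3 / 2 : ℝ≥0∞) ≠ 0 := by norm_num
  have hptop : (3 / 2 : ℝ≥0∞) ≠ ⊤ := ENNReal.div_ne_top (by simp) (by norm_num)
  rw [eLpNorm_lt_top_iff_lintegral_rpow_enorm_lt_top hp0 hptop]
  have e : (3 / 2 : ℝ≥0∞).toReal = (3 / 2 : ℝ) := by
    rw [ENNReal.toReal_div]; norm_num
  rw [e]
  exact lintegral_pressure_rpow_threeHalves_lt_top hreg hI hP

/-- **(I2) for the zoom of a solution of Theorem 1.9**: for every zoom factor `0 < c ≤ 1/32`,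
`p_c = c² p(c²·, c·) ∈ L^{3/2}(Q₁)` (change of variables, tree `MemLp.smul_uncurry_stPull`;
`Φ(Q₁) = Q_c ⊆ (−1,0) × B_{1/32}`). [cite: PineauVicol2026, proof of Prop. 9.5, arXiv:2607.09619 p. 33] -/
theorem memLp_nsRescalePressure_threeHalves
    (hreg : IsClassicalNSSolutionOnRegion (Ico (-1 : ℝ) 0 ×ˢ ball (0 : (EuclideanSpace ℝ (Fin 3))) 1) 1 0 u p)
    (hI : ∀ t ∈ Ico (-1 : ℝ) 0, ∀ x ∈ ball (0 : (EuclideanSpace ℝ (Fin 3))) 1, ‖u t x‖ ≤ Cu / (Real.sqrt (-t) + ‖x‖))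
    (hP : ∀ t ∈ Ico (-1 : ℝ) 0, ∀ x : (EuclideanSpace ℝ (Fin 3)), 1 / 2 < ‖x‖ → ‖x‖ < 3 / 4 → |p t x| ≤ Cp)
    (hc : 0 < c) (hc' : c ≤ 1 / 32) :
    MemLp (uncurry (nsRescalePressure c p)) (3 / 2)
      (volume.restrict (parabolicCylinder 1 (0 : ℝ × (EuclideanSpace ℝ (Fin 3))))) := by
  have hc1 : c ≤ 1 := hc'.trans (by norm_num)
  set Q : Opens (ℝ × (EuclideanSpace ℝ (Fin 3))) :=
    ⟨Ioo (-1 : ℝ) 0 ×ˢ ball (0 : (EuclideanSpace ℝ (Fin 3))) (1 / 32), isOpen_Ioo.prod isOpen_ball⟩ with hQ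
  have hf : MemLp (uncurry p) (3 / 2) (volume.restrict (Q : Set (ℝ × (EuclideanSpace ℝ (Fin 3))))) :=
    memLp_pressure_threeHalves hreg hI hP
  have h2 := hf.smul_uncurry_stPull (β := c ^ 2) (γ := c) (by positivity) hc 0 (0 : (EuclideanSpace ℝ (Fin 3))) (c ^ 2)
  have ep : (c ^ 2) • stPull (c ^ 2) c 0 (0 : (EuclideanSpace ℝ (Fin 3))) p = nsRescalePressure c p := by
    funext s y
    simp [stPull_apply, nsRescalePressure_apply]
  rw [ep] at h2
  refine h2.mono_measure (Measure.restrict_mono_set _ fun z hz => ?_)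
  rw [coe_stPreimage, mem_preimage]
  obtain ⟨hs, -⟩ := sq_mul_mem_Ioo_and_smul_mem_ball hc hc1 (s := z.1) (y := z.2) hz
  have hy : ‖z.2‖ < 1 := by
    have h := (mem_parabolicCylinder.1 hz).2
    simpa using h
  change (0 + c ^ 2 * z.1, (0 : (EuclideanSpace ℝ (Fin 3))) + c • z.2) ∈ Ioo (-1 : ℝ) 0 ×ˢ ball (0 : (EuclideanSpace ℝ (Fin 3))) (1 / 32)
  rw [zero_add, zero_add]
  refine mk_mem_prod hs ?_
  rw [mem_ball_zero_iff, norm_smul, Real.norm_of_nonneg hc.le]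
  nlinarith [norm_nonneg z.2]

end Slices

/-! ### Proposition 9.5 modulo the smallness of the dissipation -/

/-- **Pineau–Vicol 2026, Prop. 9.5 for the solutions of Theorem 1.9, modulo the smallness of
the dissipation only.** There is a universal `ε > 0` such that: every classical solution
`(u, p)` of Navier–Stokes (`ν = 1`, `f = 0`) on `[−1,0) × B₁` with the Type I bound (1.15) and
the annular pressure bound (1.16), and every zoom factor `0 < c ≤ 1/32` for which
`sup_{0<r<1} r⁻¹ ∫∫_{Q_r} |∇u_c|² < ε` (`u_c = c u(c²·, c·)`; ⇐ (9.14)–(9.16) via §9.3 and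
Lemma 9.4, with `c = e^{−s̄/2}`), give a solution bounded on `B_r × (−r², 0)` for some `r > 0` —
the conclusion of `pineauVicol2026_oneSlice_regularity`. All of interior suitability,
`u_c ∈ L^∞_t L²_x(Q₁)`, `∇u_c ∈ L²(Q₁)`, `p_c ∈ L^{3/2}(Q₁)` and the CKN step are proved. [cite: PineauVicol2026, Prop. 9.5 and its proof, arXiv:2607.09619 p. 32–33] -/
theorem pineauVicol_regular_of_zoom_small :
    ∃ ε : ℝ, 0 < ε ∧
      ∀ (u : ℝ → (EuclideanSpace ℝ (Fin 3)) → (EuclideanSpace ℝ (Fin 3))) (p : ℝ → (EuclideanSpace ℝ (Fin 3)) → ℝ) (Cu Cp c : ℝ),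
        IsClassicalNSSolutionOnRegion (Ico (-1 : ℝ) 0 ×ˢ ball (0 : (EuclideanSpace ℝ (Fin 3))) 1) 1 0 u p →
        (∀ t ∈ Ico (-1 : ℝ) 0, ∀ x ∈ ball (0 : (EuclideanSpace ℝ (Fin 3))) 1, ‖u t x‖ ≤ Cu / (Real.sqrt (-t) + ‖x‖)) →
        (∀ t ∈ Ico (-1 : ℝ) 0, ∀ x : (EuclideanSpace ℝ (Fin 3)), 1 / 2 < ‖x‖ → ‖x‖ < 3 / 4 → |p t x| ≤ Cp) →
        0 < c → c ≤ 1 / 32 →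
        (⨆ r ∈ Ioo (0 : ℝ) 1,
          cknE r (0 : ℝ × (EuclideanSpace ℝ (Fin 3))) (fun t x => fderiv ℝ (nsRescale c u t) x)) < ENNReal.ofReal ε →
        ∃ r : ℝ, 0 < r ∧ ∃ M : ℝ, ∀ t : ℝ, -r ^ 2 < t → t < 0 →
          ∀ x ∈ ball (0 : (EuclideanSpace ℝ (Fin 3))) r, ‖u t x‖ ≤ M := by
  obtain ⟨ε, hε, H⟩ := pineauVicol_regular_of_zoom
  refine ⟨ε, hε, fun u p Cu Cp c hreg hI hP hc hc' hE => ?_⟩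
  have hc2 : c ≤ 1 / 2 := hc'.trans (by norm_num)
  exact H u p Cu c hreg hI hc (by linarith)
    (lintegral_parabolicCylinder_one_fderiv_nsRescale_lt_top hreg hI hP hc hc2)
    (memLp_nsRescalePressure_threeHalves hreg hI hP hc hc') hE

end Literature.Analysis.FluidPDE

end
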